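import Literature.IUT.HodgeTheaters.GoodLocalFrobenioidOfGaloisSplitFromF
import HarnessLib

/-!
# [IUTchI] Example 3.3 (iii) (e) at the genuine datum: the anabelian input (E2) in CONJUGACY SHAPE

Mochizuki, *Inter-universal Teichmüller theory I*, kurims manuscript (May 2020), Example 3.3 (iii) (e), p. 79
[claim: Mochizuki2012, status: disputed]: "(e) … one may reconstruct the split Frobenioids `F⊢_v`, `F^Θ_v`
category-theoretically from `F̲_v`" (anabelian input of the preceding sentence: [AbsTopIII], Proposition 3.2, (iii), for
`X̲→_v` of strictly Belyi type) — nothing of the series is asserted; no side is taken on [IUTchIII] Cor. 3.12.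

PROOF-ONLY file (abc-iut cell, seat abc-iut-L5-t16 gen 8; sub-DAG SUBDAG-IUTchI-Ex33-Ex34 row E33iii/e, the (E2) consumer
glue), no definitions, no new `Prop`.  The closers of `GoodLocalFrobenioidOfGaloisSplitFromF.lean` (abc-iut-L5-t16 gen 7)
carry ONE hypothesis, (E2) in the shape «`hE2`: every bicontinuous automorphism `φ` of `Π_v` is covered by a
VALUATION-PRESERVING ring automorphism `σ` of `k̄ = (GaloisValDatum.ofComplete p k).Ω` with `σ(aug(g)·x) = aug(φ g)·σ(x)`».
Print's input ([AbsTopIII] Thm. 1.9 / Cor. 1.10 (iii) with its functoriality, Galois side; the tree's named fact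
`Literature.AnabelianGeometry.AbsoluteAnabelian.AbsTopIII.TemperedAutOverGQp`) delivers it in CONJUGACY SHAPE:
«`∀ α ∃ τ ∈ G_{ℚ_p} ∀ x, aug(α x) = τ · aug(x) · τ⁻¹`» — NO valuation clause.  This file closes the gap on L5's carrier:
* §1 (classical) **every `ℚ_p`-algebra automorphism of `k̄ = AlgebraicClosure k` is an isometry of the spectral
  valuation** (`GaloisValDatum.spectralNorm_closure_eq_padic`, `…spectralNorm_closure_map_eq_of_commutes`,
  `…ofComplete_valuation_eq_of_commutes`, `…ofComplete_valuation_algEquiv_padic_eq`): `‖·‖_sp` and `‖σ(·)‖_sp` are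
  absolute values on the algebraic extension `k̄` of the COMPLETE field `ℚ_p` extending `‖·‖_p`, hence both are the
  spectral norm over `ℚ_p` (Mathlib `spectralNorm_unique_field_norm_ext`; Neukirch, ANT, Ch. II Thm. (4.8); pattern of
  the tree's `Literature.NumberTheory.PAdicHodge.BaseGaloisGroup.norm_smul`); and the «ℚ̄_p dictionary», valued half: a
  `ℚ_p`-algebra isomorphism `e : k̄ ≃ ℚ̄_p := PadicAlgCl p` EXISTS (`…nonempty_algEquiv_padicAlgCl`) and EVERY such `e` is an
  isomorphism of VALUED fields (`…norm_map_algEquiv_padicAlgCl`, `…vle_map_algEquiv_padicAlgCl_iff`);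
* §2 **(E2) in conjugacy shape implies `hE2`** — pointwise form `aug(φ g) (τ x) = τ (aug(g) x)`
  (`GoodLocalFrobenioid.hE2_of_conj`), group form `res(aug(φ g)) = τ * res(aug g) * τ⁻¹` in `Aut_{ℚ_p-alg}(k̄)`, `res` the
  restriction of scalars (`…hE2_of_conj_restrictScalars`), and the same with `τ` in the literal
  `G_{ℚ_p} = Aut_{ℚ_p-alg}(AlgebraicClosure ℚ_[p])` after transport along any `e` (`…conj_restrictScalars_of_conj_autCongr`);
* §3 the RE-TARGETED CLOSERS `GoodLocalFrobenioid.isPreservedBy_pSplitting_ofGalois_ofComplete_of_conj`,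
  `…splitFromF_ofGalois_ofComplete_of_conj` ((e) at the genuine datum) and
  `InitialThetaData.splitFromF_goodLocalFrobenioidOfEmb_of_conj` / `…_restrictScalars` / `…_autCongr` ((e) at the printed
  object of abc-iut-L5-t2's Def. 3.1 datum): modulo the conjugacy-shape input ONLY — no valuation / field-action clause.
What remains between these closers and an APPLICATION of `TemperedAutOverGQp` is the identification of L5's `Π_v̲` with an
open subgroup of finite index of the tempered group of an [EtTh] §1 setting compatibly with the augmentations (cell
bookkeeping, the «merge map») — NOT done here; nothing of [AbsTopIII] / [EtTh] / [SemiAnbd] is restated or imported.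
(E2) in either shape stays a displayed HYPOTHESIS; typed ≠ proved.
-/

noncomputable section

namespace Literature.IUT.HodgeTheaters

/-! ### §1 `ℚ_p`-algebra automorphisms of `k̄` are isometries of the spectral valuation -/

namespace GaloisValDatum

section PadicIsometry

variable (p : ℕ) [Fact p.Prime] (k : Type) [NontriviallyNormedField k] [CompleteSpace k] [IsUltrametricDist k]
  [NormedAlgebra ℚ_[p] k] [FiniteDimensional ℚ_[p] k]

omit [CompleteSpace k] [IsUltrametricDist k] in
/-- `k̄` is algebraic over `ℚ_p` (`k/ℚ_p` finite, `k̄/k` algebraic). [cite: NeukirchANT1999, Ch. II Thm. (4.8)] -/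
theorem closure_isAlgebraic_padic : Algebra.IsAlgebraic ℚ_[p] (AlgebraicClosure k) :=
  haveI : Algebra.IsAlgebraic ℚ_[p] k := Algebra.IsAlgebraic.of_finite ℚ_[p] k
  Algebra.IsAlgebraic.trans ℚ_[p] k (AlgebraicClosure k)

/-- **The spectral norm of `k̄/k` is the spectral norm of `k̄/ℚ_p`**: both are absolute values on the algebraic
extension `k̄` of the complete field `ℚ_p` extending `‖·‖_p` (uniqueness, Mathlib `spectralNorm_unique_field_norm_ext`).
[cite: NeukirchANT1999, Ch. II Thm. (4.8)] -/
theorem spectralNorm_closure_eq_padic (x : AlgebraicClosure k) :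
    spectralNorm k (AlgebraicClosure k) x = spectralNorm ℚ_[p] (AlgebraicClosure k) x := by
  letI := closureNormedField k
  haveI := closure_isAlgebraic_padic p k
  let f : AbsoluteValue (AlgebraicClosure k) ℝ :=
    { toFun := fun y => ‖y‖
      map_mul' := fun y z => norm_mul y z
      nonneg' := fun y => norm_nonneg y
      eq_zero' := fun y => norm_eq_zero
      add_le' := fun y z => norm_add_le y z }
  have hf : ∀ c : ℚ_[p], f (algebraMap ℚ_[p] (AlgebraicClosure k) c) = ‖c‖ := by
    intro c
    change spectralNorm k (AlgebraicClosure k) (algebraMap ℚ_[p] (AlgebraicClosure k) c) = ‖c‖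
    rw [IsScalarTower.algebraMap_apply ℚ_[p] k (AlgebraicClosure k), spectralNorm_extends, norm_algebraMap']
  exact spectralNorm_unique_field_norm_ext hf x

/-- **Any `ℚ_p`-algebra isomorphism from `k̄` onto a field `L` algebraic over `ℚ_p` carries the spectral norm of `k̄/k`
to the spectral norm of `L/ℚ_p`** (again by uniqueness over the complete field `ℚ_p`).
[cite: NeukirchANT1999, Ch. II Thm. (4.8)] -/
theorem spectralNorm_map_algEquiv_padic {L : Type*} [Field L] [Algebra ℚ_[p] L] [Algebra.IsAlgebraic ℚ_[p] L]
    (e : AlgebraicClosure k ≃ₐ[ℚ_[p]] L) (x : AlgebraicClosure k) :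
    spectralNorm ℚ_[p] L (e x) = spectralNorm k (AlgebraicClosure k) x := by
  haveI := closure_isAlgebraic_padic p k
  let f : AbsoluteValue (AlgebraicClosure k) ℝ :=
    { toFun := fun y => spectralMulAlgNorm ℚ_[p] L (e y)
      map_mul' := fun y z => by simp only [map_mul]
      nonneg' := fun y => apply_nonneg _ _
      eq_zero' := fun y =>
        (map_eq_zero_iff_eq_zero (spectralMulAlgNorm ℚ_[p] L)).trans (EmbeddingLike.map_eq_zero_iff (f := e))
      add_le' := fun y z => by simp only [map_add]; exact map_add_le_add _ _ _ }
  have hf : ∀ c : ℚ_[p], f (algebraMap ℚ_[p] (AlgebraicClosure k) c) = ‖c‖ := by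
    intro c
    change spectralMulAlgNorm ℚ_[p] L (e (algebraMap ℚ_[p] (AlgebraicClosure k) c)) = ‖c‖
    rw [AlgEquiv.commutes, spectralMulAlgNorm_def, spectralNorm_extends]
  calc spectralNorm ℚ_[p] L (e x) = f x := rfl
    _ = spectralNorm ℚ_[p] (AlgebraicClosure k) x := spectralNorm_unique_field_norm_ext hf x
    _ = spectralNorm k (AlgebraicClosure k) x := (spectralNorm_closure_eq_padic p k x).symm

/-- **Every ring automorphism of `k̄` fixing `ℚ_p` pointwise preserves the spectral norm of `k̄/k`.**
[cite: NeukirchANT1999, Ch. II Thm. (4.8)] -/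
theorem spectralNorm_closure_map_eq_of_commutes (σ : AlgebraicClosure k ≃+* AlgebraicClosure k)
    (hσ : ∀ a : ℚ_[p], σ (algebraMap ℚ_[p] (AlgebraicClosure k) a) = algebraMap ℚ_[p] (AlgebraicClosure k) a)
    (x : AlgebraicClosure k) :
    spectralNorm k (AlgebraicClosure k) (σ x) = spectralNorm k (AlgebraicClosure k) x := by
  haveI := closure_isAlgebraic_padic p k
  rw [spectralNorm_closure_eq_padic p k (σ x)]
  exact spectralNorm_map_algEquiv_padic p k (AlgEquiv.ofRingEquiv (f := σ) hσ) x

/-- The same for the valuation of the valuative relation `closureVal k` of the spectral norm.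
[cite: NeukirchANT1999, Ch. II Thm. (4.8)] -/
theorem closure_valuation_eq_of_commutes (σ : AlgebraicClosure k ≃+* AlgebraicClosure k)
    (hσ : ∀ a : ℚ_[p], σ (algebraMap ℚ_[p] (AlgebraicClosure k) a) = algebraMap ℚ_[p] (AlgebraicClosure k) a)
    (x : AlgebraicClosure k) :
    @ValuativeRel.valuation _ _ (closureVal k) (σ x) = @ValuativeRel.valuation _ _ (closureVal k) x := by
  letI : ValuativeRel (AlgebraicClosure k) := closureVal k
  have h := spectralNorm_closure_map_eq_of_commutes p k σ hσ x
  apply le_antisymm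
  · rw [← Valuation.Compatible.vle_iff_le, closureVal_iff]
    exact h.le
  · rw [← Valuation.Compatible.vle_iff_le, closureVal_iff]
    exact h.ge

/-- **Every ring automorphism of `(ofComplete p k).Ω = k̄` fixing `ℚ_p` pointwise preserves the valuation of the genuine
datum of [IUTchI] Ex. 3.3 (i)** (the «valued half» of the identification `k̄ ↔ ℚ̄_p` asked for the (E2) binder).
[cite: NeukirchANT1999, Ch. II Thm. (4.8)] -/
theorem ofComplete_valuation_eq_of_commutes (σ : (ofComplete p k).Ω ≃+* (ofComplete p k).Ω)
    (hσ : ∀ a : ℚ_[p], σ (algebraMap ℚ_[p] (AlgebraicClosure k) a) = algebraMap ℚ_[p] (AlgebraicClosure k) a)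
    (x : (ofComplete p k).Ω) :
    ValuativeRel.valuation (ofComplete p k).Ω (σ x) = ValuativeRel.valuation (ofComplete p k).Ω x :=
  closure_valuation_eq_of_commutes p k σ hσ x

/-- **Every `ℚ_p`-algebra automorphism `τ` of `k̄` (an element of `Gal(k̄/ℚ_p) ≅ G_{ℚ_p}`) preserves the valuation of
`(ofComplete p k).Ω`.** [cite: NeukirchANT1999, Ch. II Thm. (4.8)] -/
theorem ofComplete_valuation_algEquiv_padic_eq (τ : AlgebraicClosure k ≃ₐ[ℚ_[p]] AlgebraicClosure k)
    (x : (ofComplete p k).Ω) :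
    ValuativeRel.valuation (ofComplete p k).Ω (τ x) = ValuativeRel.valuation (ofComplete p k).Ω x :=
  closure_valuation_eq_of_commutes p k τ.toRingEquiv (fun a => τ.commutes a) x

/-! #### The valued identification `k̄ ≅ ℚ̄_p` along ANY `ℚ_p`-algebra isomorphism -/

/-- **At `L := ℚ̄_p` (Mathlib `PadicAlgCl p = AlgebraicClosure ℚ_[p]` with its `p`-adic norm): any `ℚ_p`-algebra
isomorphism `e : k̄ ≃ ℚ̄_p` is an ISOMETRY for the spectral norm of `k̄/k`.** [cite: NeukirchANT1999, Ch. II Thm. (4.8)] -/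
theorem norm_map_algEquiv_padicAlgCl (e : AlgebraicClosure k ≃ₐ[ℚ_[p]] PadicAlgCl p) (x : AlgebraicClosure k) :
    ‖e x‖ = spectralNorm k (AlgebraicClosure k) x := by
  rw [← PadicAlgCl.spectralNorm_eq p (e x)]
  exact spectralNorm_map_algEquiv_padic p k e x

/-- **The «ℚ̄_p dictionary», valued half: any `ℚ_p`-algebra isomorphism `k̄ ≃ ℚ̄_p` is an isomorphism of VALUED fields**
between the Galois closure `(ofComplete p k).Ω = k̄` of the genuine datum (relation `closureVal k`) and the Galois closure
`(ofPadic p).Ω = ℚ̄_p` of abc-iut-L5-t2's datum at `ℚ_p` (relation `padicAlgClVal p`).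
[cite: NeukirchANT1999, Ch. II Thm. (4.8)] -/
theorem vle_map_algEquiv_padicAlgCl_iff (e : AlgebraicClosure k ≃ₐ[ℚ_[p]] PadicAlgCl p) (x y : AlgebraicClosure k) :
    @ValuativeRel.vle _ _ (padicAlgClVal p) (e x) (e y) ↔ @ValuativeRel.vle _ _ (closureVal k) x y := by
  rw [padicAlgCl_vle_iff, closureVal_iff, norm_map_algEquiv_padicAlgCl, norm_map_algEquiv_padicAlgCl]

/-- The same for a `k`-ALGEBRA isomorphism `ℚ̄_p ≃ₐ[k] k̄` when `ℚ̄_p` is given as a `k`-algebra over `ℚ_p` (the shape of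
the tree's `Literature.FieldTheory.Galois.algEquivAlgebraicClosure : AlgebraicClosure ℚ_[p] ≃ₐ[K] AlgebraicClosure K` for a
finite `K/ℚ_p` inside `ℚ̄_p`): it respects the valuations `padicAlgClVal p` / `closureVal k`.
[cite: NeukirchANT1999, Ch. II Thm. (4.8)] -/
theorem vle_map_algEquiv_of_padicAlgCl_iff [Algebra k (PadicAlgCl p)] [IsScalarTower ℚ_[p] k (PadicAlgCl p)]
    (e : PadicAlgCl p ≃ₐ[k] AlgebraicClosure k) (x y : PadicAlgCl p) :
    @ValuativeRel.vle _ _ (closureVal k) (e x) (e y) ↔ @ValuativeRel.vle _ _ (padicAlgClVal p) x y := by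
  rw [← vle_map_algEquiv_padicAlgCl_iff p k (e.symm.restrictScalars ℚ_[p]) (e x) (e y)]
  simp only [AlgEquiv.restrictScalars_apply, AlgEquiv.symm_apply_apply]

omit [CompleteSpace k] [IsUltrametricDist k] in
/-- `k̄` is an algebraic closure of `ℚ_p`. [cite: NeukirchANT1999, Ch. II Thm. (4.8)] -/
theorem closure_isAlgClosure_padic : IsAlgClosure ℚ_[p] (AlgebraicClosure k) :=
  haveI := closure_isAlgebraic_padic p k
  { isAlgClosed := inferInstance, isAlgebraic := inferInstance }

omit [CompleteSpace k] [IsUltrametricDist k] in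
/-- Hence a `ℚ_p`-algebra isomorphism `k̄ ≃ ℚ̄_p` EXISTS (uniqueness of algebraic closures), and by
`vle_map_algEquiv_padicAlgCl_iff` every such isomorphism respects the valuations. [cite: NeukirchANT1999, Ch. II Thm. (4.8)] -/
theorem nonempty_algEquiv_padicAlgCl : Nonempty (AlgebraicClosure k ≃ₐ[ℚ_[p]] PadicAlgCl p) :=
  haveI := closure_isAlgClosure_padic p k
  ⟨IsAlgClosure.equiv ℚ_[p] (AlgebraicClosure k) (PadicAlgCl p)⟩

end PadicIsometry

end GaloisValDatum

/-! ### §2 (E2) in conjugacy shape implies the binder `hE2` -/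

namespace GoodLocalFrobenioid

section Conj

/-! The augmentation is typed on the literal carrier `Gal(k̄/k) = AlgebraicClosure k ≃ₐ[k] AlgebraicClosure k`
(`= (GaloisValDatum.ofComplete p k).Gal` by `rfl`; the codomain of abc-iut-L5-t2's `InitialThetaData.augLoc` at
`Γ := Gal(k̄/k)`), so that Mathlib's restriction of scalars `res := AlgEquiv.restrictScalars ℚ_[p]` applies verbatim. -/

variable (p : ℕ) [Fact p.Prime] (k : Type) [NontriviallyNormedField k] [CompleteSpace k] [IsUltrametricDist k]
  [NormedAlgebra ℚ_[p] k] [FiniteDimensional ℚ_[p] k] {P : Type} [Group P] [TopologicalSpace P]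
  (aug : P →* (AlgebraicClosure k ≃ₐ[k] AlgebraicClosure k))

/-- **(E2) in CONJUGACY SHAPE ⟹ `hE2`.**  If every bicontinuous automorphism `φ` of `Π_v` lies over conjugation by a
`ℚ_p`-algebra automorphism `τ` of `k̄` — `aug(φ g) ∘ τ = τ ∘ aug(g)` on `k̄`, the pointwise reading of
«`aug(φ g) = τ · aug(g) · τ⁻¹`, `τ ∈ G_{ℚ_p}`» ([AbsTopIII] Cor. 1.10 (iii), Galois side) — then `φ` is covered by the
valuation-preserving ring automorphism `σ := τ` with `σ(aug(g)·x) = aug(φ g)·σ(x)`: the valuation clause is §1.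
[cite: NeukirchANT1999, Ch. II Thm. (4.8)] -/
theorem hE2_of_conj
    (hconj : ∀ φ : P ≃ₜ* P, ∃ τ : AlgebraicClosure k ≃ₐ[ℚ_[p]] AlgebraicClosure k,
      ∀ (g : P) (x : (GaloisValDatum.ofComplete p k).Ω), (aug (φ g)) (τ x) = τ ((aug g) x)) :
    ∀ φ : P ≃ₜ* P, ∃ σ : (GaloisValDatum.ofComplete p k).Ω ≃+* (GaloisValDatum.ofComplete p k).Ω,
      (∀ x, ValuativeRel.valuation (GaloisValDatum.ofComplete p k).Ω (σ x) =
          ValuativeRel.valuation (GaloisValDatum.ofComplete p k).Ω x) ∧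
        ∀ (g : P) (x : (GaloisValDatum.ofComplete p k).Ω), σ ((aug g) x) = (aug (φ g)) (σ x) := by
  intro φ
  obtain ⟨τ, hτ⟩ := hconj φ
  exact ⟨τ.toRingEquiv, fun x => GaloisValDatum.ofComplete_valuation_algEquiv_padic_eq p k τ x,
    fun g x => (hτ g x).symm⟩

omit [CompleteSpace k] [IsUltrametricDist k] [FiniteDimensional ℚ_[p] k] [TopologicalSpace P] in
/-- **Group form ⟹ pointwise form.**  With `res : Gal(k̄/k) → Aut_{ℚ_p-alg}(k̄)` the restriction of scalars along
`ℚ_p → k`, the hypothesis «`∀ φ ∃ τ ∀ g, res(aug(φ g)) = τ * res(aug g) * τ⁻¹`» (conjugation INSIDE the group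
`Aut_{ℚ_p-alg}(k̄) ≅ G_{ℚ_p}`, the literal shape of the tree's `AbsTopIII.TemperedAutOverGQp`) gives the pointwise form
«`aug(φ g) (τ x) = τ (aug(g) x)`» consumed by `hE2_of_conj`. [cite: MochizukiAbsTopIII2015, Cor 1.10 (iii) p.43] -/
theorem conj_apply_of_conj_restrictScalars {Φ : Type} (act : Φ → P → P)
    (hconj : ∀ φ : Φ, ∃ τ : AlgebraicClosure k ≃ₐ[ℚ_[p]] AlgebraicClosure k, ∀ g : P,
      AlgEquiv.restrictScalars ℚ_[p] (aug (act φ g)) = τ * AlgEquiv.restrictScalars ℚ_[p] (aug g) * τ⁻¹) :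
    ∀ φ : Φ, ∃ τ : AlgebraicClosure k ≃ₐ[ℚ_[p]] AlgebraicClosure k,
      ∀ (g : P) (x : AlgebraicClosure k), (aug (act φ g)) (τ x) = τ ((aug g) x) := by
  intro φ
  obtain ⟨τ, hτ⟩ := hconj φ
  refine ⟨τ, fun g x => ?_⟩
  have h := congrArg (fun e : AlgebraicClosure k ≃ₐ[ℚ_[p]] AlgebraicClosure k => e (τ x)) (hτ g)
  simp only [AlgEquiv.mul_apply, AlgEquiv.aut_inv, AlgEquiv.symm_apply_apply] at h
  exact h

/-- **Group form ⟹ `hE2`** (for the datum `GaloisValDatum.ofComplete p k`, whose `Gal` IS `Gal(k̄/k)`).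
[cite: MochizukiAbsTopIII2015, Cor 1.10 (iii) p.43] -/
theorem hE2_of_conj_restrictScalars
    (hconj : ∀ φ : P ≃ₜ* P, ∃ τ : AlgebraicClosure k ≃ₐ[ℚ_[p]] AlgebraicClosure k, ∀ g : P,
      AlgEquiv.restrictScalars ℚ_[p] (aug (φ g)) = τ * AlgEquiv.restrictScalars ℚ_[p] (aug g) * τ⁻¹) :
    ∀ φ : P ≃ₜ* P, ∃ σ : (GaloisValDatum.ofComplete p k).Ω ≃+* (GaloisValDatum.ofComplete p k).Ω,
      (∀ x, ValuativeRel.valuation (GaloisValDatum.ofComplete p k).Ω (σ x) =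
          ValuativeRel.valuation (GaloisValDatum.ofComplete p k).Ω x) ∧
        ∀ (g : P) (x : (GaloisValDatum.ofComplete p k).Ω), σ ((aug g) x) = (aug (φ g)) (σ x) :=
  hE2_of_conj p k aug (conj_apply_of_conj_restrictScalars p k aug (fun φ : P ≃ₜ* P => (φ : P → P)) hconj)

omit [CompleteSpace k] [IsUltrametricDist k] [FiniteDimensional ℚ_[p] k] [TopologicalSpace P] in
/-- **Transport to the literal `G_{ℚ_p}`.**  For ANY `ℚ_p`-algebra isomorphism `e : k̄ ≃ ℚ̄_p := AlgebraicClosure ℚ_[p]`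
(both are algebraic closures of `ℚ_p`), conjugacy of `e ∘ res(aug(·)) ∘ e⁻¹` by an element
`τ ∈ G_{ℚ_p} = Aut_{ℚ_p-alg}(AlgebraicClosure ℚ_[p])` (the codomain of the tree's `TemperedAutOverGQp`) is conjugacy of
`res(aug(·))` by `e⁻¹ τ e ∈ Aut_{ℚ_p-alg}(k̄)` (Mathlib `AlgEquiv.autCongr`). [cite: MochizukiAbsTopIII2015, Cor 1.10 (iii) p.43] -/
theorem conj_restrictScalars_of_conj_autCongr {Φ : Type} (act : Φ → P → P)
    (e : AlgebraicClosure k ≃ₐ[ℚ_[p]] AlgebraicClosure ℚ_[p])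
    (hconj : ∀ φ : Φ, ∃ τ : AlgebraicClosure ℚ_[p] ≃ₐ[ℚ_[p]] AlgebraicClosure ℚ_[p], ∀ g : P,
      e.autCongr (AlgEquiv.restrictScalars ℚ_[p] (aug (act φ g))) =
        τ * e.autCongr (AlgEquiv.restrictScalars ℚ_[p] (aug g)) * τ⁻¹) :
    ∀ φ : Φ, ∃ τ : AlgebraicClosure k ≃ₐ[ℚ_[p]] AlgebraicClosure k, ∀ g : P,
      AlgEquiv.restrictScalars ℚ_[p] (aug (act φ g)) = τ * AlgEquiv.restrictScalars ℚ_[p] (aug g) * τ⁻¹ := by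
  intro φ
  obtain ⟨τ, hτ⟩ := hconj φ
  refine ⟨e.autCongr.symm τ, fun g => ?_⟩
  apply e.autCongr.injective
  rw [hτ g, map_mul, map_mul, MulEquiv.apply_symm_apply, map_inv, MulEquiv.apply_symm_apply]

end Conj

/-! ### §3 The re-targeted closers: (e) modulo (E2) in conjugacy shape only -/

section Genuine

open CategoryTheory ValuativeRel Topology Literature.AnabelianGeometry.SemiGraphs
open Literature.AlgebraicGeometry.Frobenioids Literature.AlgebraicGeometry.Frobenioids.PadicFrd

variable (p : ℕ) [Fact p.Prime] (k : Type) [NontriviallyNormedField k] [CompleteSpace k] [IsUltrametricDist k]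
  [NormedAlgebra ℚ_[p] k] [FiniteDimensional ℚ_[p] k] {P : Type} [Group P] [TopologicalSpace P]
  (aug : P →* (GaloisValDatum.ofComplete p k).Gal) (hc : Continuous aug) (hs : Function.Surjective aug)
  (ho : IsOpenMap aug) (Kv : Type) [Field Kv] [ValuativeRel Kv] (hp : ((p : Kv)) ∈ PadicFrd.intNonzero Kv)

/-- **[IUTchI] Ex. 3.3 (iii) (e), the characteristic splitting, AT THE GENUINE DATUM `k̄/K_v`, modulo (E2) in CONJUGACY
SHAPE**: if every bicontinuous automorphism `φ` of `Π_v` lies over conjugation by some `τ ∈ Aut_{ℚ_p-alg}(k̄) ≅ G_{ℚ_p}`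
(`aug(φ g) ∘ τ = τ ∘ aug(g)`; [AbsTopIII] Thm. 1.9 / Cor. 1.10 (iii), Galois side — a HYPOTHESIS), then every
self-equivalence of the REAL `p_v`-adic Frobenioid `C_v` carries `τ_{p_v}(A)` onto `τ_{p_v}(e A)`; no valuation clause is
assumed (§1). ([IUTchI] Ex 3.3 (iii) (e) p.79) [claim: Mochizuki2012, status: disputed] -/
theorem isPreservedBy_pSplitting_ofGalois_ofComplete_of_conj [IsTopologicalGroup P] [SecondCountableTopology P]
    (hP : IsTempered P) (hΔ : ∀ φ : P ≃ₜ* P, aug.ker.map φ.toMulEquiv.toMonoidHom = aug.ker) (hsl : IsSlim (CosetCat P))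
    (hconj : ∀ φ : P ≃ₜ* P, ∃ τ : AlgebraicClosure k ≃ₐ[ℚ_[p]] AlgebraicClosure k,
      ∀ (g : P) (x : (GaloisValDatum.ofComplete p k).Ω), (aug (φ g)) (τ x) = τ ((aug g) x))
    (e : (ofGalois (GaloisValDatum.ofComplete p k) aug hc hs ho Kv hp).Cv ≌
      (ofGalois (GaloisValDatum.ofComplete p k) aug hc hs ho Kv hp).Cv) :
    S3Local.CharSplitting.IsPreservedBy
      ⟨(Datum.perf (CosetCat.push aug ho ⋙ (GaloisValDatum.ofComplete p k).fieldFunctor)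
          (hlocOver (CosetCat.push aug ho) (GaloisValDatum.ofComplete p k).fieldFunctor
            (GaloisValDatum.ofComplete p k).fieldFunctor_isPadicLocal)
          CosetCat.isConnected CosetCat.isTotallyEpimorphic).pSplittingSubmonoid⟩
      ⟨(Datum.perf (CosetCat.push aug ho ⋙ (GaloisValDatum.ofComplete p k).fieldFunctor)
          (hlocOver (CosetCat.push aug ho) (GaloisValDatum.ofComplete p k).fieldFunctor
            (GaloisValDatum.ofComplete p k).fieldFunctor_isPadicLocal)
          CosetCat.isConnected CosetCat.isTotallyEpimorphic).pSplittingSubmonoid⟩ e.functor :=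
  isPreservedBy_pSplitting_ofGalois_ofComplete p k aug hc hs ho Kv hp hP hΔ hsl (hE2_of_conj p k aug hconj) e

/-- **[IUTchI] Ex. 3.3 (iii) (e) `SplitFromF` AT THE GENUINE DATUM `k̄/K_v`, modulo (E2) in CONJUGACY SHAPE** (every
bicontinuous automorphism of `Π_v` lies over conjugation by an element of `Aut_{ℚ_p-alg}(k̄) ≅ G_{ℚ_p}` — a HYPOTHESIS; no
valuation clause): every self-equivalence of `F̲_v = C_v` lifts `τ⊢_v`/`τ^Θ_v`-compatibly to `C⊢_v`, `C^Θ_v`.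
Inputs otherwise as in `splitFromF_ofGalois_ofComplete` (`hΔ` = [AbsAnab] Lem. 1.3.8 shape, slimness).
([IUTchI] Ex 3.3 (iii) (e) p.79) [claim: Mochizuki2012, status: disputed] -/
theorem splitFromF_ofGalois_ofComplete_of_conj [IsTopologicalGroup P] [SecondCountableTopology P]
    (hP : IsTempered P) (hΔ : ∀ φ : P ≃ₜ* P, aug.ker.map φ.toMulEquiv.toMonoidHom = aug.ker) (hsl : IsSlim (CosetCat P))
    (hconj : ∀ φ : P ≃ₜ* P, ∃ τ : AlgebraicClosure k ≃ₐ[ℚ_[p]] AlgebraicClosure k,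
      ∀ (g : P) (x : (GaloisValDatum.ofComplete p k).Ω), (aug (φ g)) (τ x) = τ ((aug g) x)) :
    (ofGalois (GaloisValDatum.ofComplete p k) aug hc hs ho Kv hp).SplitFromF :=
  splitFromF_ofGalois_ofComplete p k aug hc hs ho Kv hp hP hΔ hsl (hE2_of_conj p k aug hconj)

end Genuine

end GoodLocalFrobenioid

section Datum

open CategoryTheory Literature.AnabelianGeometry.SemiGraphs Literature.AlgebraicGeometry.Frobenioids
open Literature.AlgebraicGeometry.Frobenioids.PadicFrd Literature.AnabelianGeometry.AbsoluteAnabelian ValuativeRel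

universe v w

variable {F : Type v} {K : Type w} {Fbar : Type} [Field F] [NumberField F] [Field K] [NumberField K]
  [Algebra F K] [Field Fbar] [Algebra F Fbar] [Algebra K Fbar] [IsScalarTower F K Fbar] [Normal K Fbar]
  {E : WeierstrassCurve F} [E.IsElliptic] {l : ℕ} {Pb : BadPlacePredicates K}
  (D : InitialThetaData F K Fbar E l Pb) (p : ℕ) [Fact p.Prime]
  (k : Type) [NontriviallyNormedField k] [CompleteSpace k] [IsUltrametricDist k] [NormedAlgebra ℚ_[p] k]
  [FiniteDimensional ℚ_[p] k] [Algebra K k]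

namespace InitialThetaData

/-- **[IUTchI] Ex. 3.3 (iii) (e) AT THE PRINTED OBJECT, modulo the anabelian input (E2) in CONJUGACY SHAPE only.**  For
abc-iut-L5-t2's Def. 3.1 datum `D` at `v̲ ∈ V̲^good ∩ V̲^non`, `K_v̲ = k`, `Π_v̲ := Π_{X̲→_K} ×_{G_K} Gal(k̄/k)` along
`ι : F̄ → k̄`: GIVEN `hX` (Def. 3.1 (f)), the density of `K` in `k`, the named inputs `hΔC` ([AbsAnab] Lem. 1.3.1, FACT
F-0004) and `hΔ` ([AbsAnab] Lem. 1.3.8, FACT F-0007 shape), and (E2) as «every bicontinuous automorphism `φ` of `Π_v̲`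
lies over conjugation by some `τ ∈ Aut_{ℚ_p-alg}(k̄) ≅ G_{ℚ_p}`: `aug(φ g) ∘ τ = τ ∘ aug(g)`» ([AbsTopIII] Thm. 1.9 /
Cor. 1.10 (iii), Galois side, for `X̲→_v̲` of strictly Belyi type — the shape of the tree's `AbsTopIII.TemperedAutOverGQp`;
a HYPOTHESIS), the split Frobenioids `F⊢_v̲`, `F^Θ_v̲` are reconstructible from `F̲_v̲ = C_v̲` (`SplitFromF`).  The
valuation clause of gen 7's `hE2` is DISCHARGED (§1). ([IUTchI] Ex 3.3 (iii) (e) p.79) [claim: Mochizuki2012, status: disputed] -/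
theorem splitFromF_goodLocalFrobenioidOfEmb_of_conj [SecondCountableTopology D.PiC]
    (ι : Fbar →ₐ[K] AlgebraicClosure k) (hX : IsOpen (D.PiXarrow : Set D.PiC)) (hd : DenseRange (algebraMap K k))
    (hΔC : IsSlimGroup D.DeltaC)
    (hΔ : ∀ φ : D.PiLoc D.PiXarrow (localToGF F k ι) ≃ₜ* D.PiLoc D.PiXarrow (localToGF F k ι),
      (D.augLoc D.PiXarrow (localToGF F k ι)).ker.map φ.toMulEquiv.toMonoidHom =
        (D.augLoc D.PiXarrow (localToGF F k ι)).ker)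
    (hconj : ∀ φ : D.PiLoc D.PiXarrow (localToGF F k ι) ≃ₜ* D.PiLoc D.PiXarrow (localToGF F k ι),
      ∃ τ : AlgebraicClosure k ≃ₐ[ℚ_[p]] AlgebraicClosure k,
        ∀ (g : D.PiLoc D.PiXarrow (localToGF F k ι)) (x : AlgebraicClosure k),
          (D.augLoc D.PiXarrow (localToGF F k ι) (φ g)) (τ x) = τ ((D.augLoc D.PiXarrow (localToGF F k ι) g) x)) :
    @GoodLocalFrobenioid.SplitFromF p k _ (GaloisValDatum.normVal k) (D.goodLocalFrobenioidOfEmb p k ι hX) :=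
  D.splitFromF_goodLocalFrobenioidOfEmb p k ι hX hd hΔC hΔ
    (GoodLocalFrobenioid.hE2_of_conj p k (D.augLoc D.PiXarrow (localToGF F k ι)) hconj)

/-- **The same with (E2) in GROUP form** — «`∀ φ ∃ τ ∈ Aut_{ℚ_p-alg}(k̄) ∀ g, res(aug(φ g)) = τ * res(aug g) * τ⁻¹`»,
`res` the restriction of scalars `Gal(k̄/k) → Aut_{ℚ_p-alg}(k̄)` (the literal conjugacy shape of
`AbsTopIII.TemperedAutOverGQp`, read on L5's carrier `k̄ = AlgebraicClosure k`). ([IUTchI] Ex 3.3 (iii) (e) p.79)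
[claim: Mochizuki2012, status: disputed] -/
theorem splitFromF_goodLocalFrobenioidOfEmb_of_conj_restrictScalars [SecondCountableTopology D.PiC]
    (ι : Fbar →ₐ[K] AlgebraicClosure k) (hX : IsOpen (D.PiXarrow : Set D.PiC)) (hd : DenseRange (algebraMap K k))
    (hΔC : IsSlimGroup D.DeltaC)
    (hΔ : ∀ φ : D.PiLoc D.PiXarrow (localToGF F k ι) ≃ₜ* D.PiLoc D.PiXarrow (localToGF F k ι),
      (D.augLoc D.PiXarrow (localToGF F k ι)).ker.map φ.toMulEquiv.toMonoidHom =
        (D.augLoc D.PiXarrow (localToGF F k ι)).ker)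
    (hconj : ∀ φ : D.PiLoc D.PiXarrow (localToGF F k ι) ≃ₜ* D.PiLoc D.PiXarrow (localToGF F k ι),
      ∃ τ : AlgebraicClosure k ≃ₐ[ℚ_[p]] AlgebraicClosure k, ∀ g : D.PiLoc D.PiXarrow (localToGF F k ι),
        AlgEquiv.restrictScalars ℚ_[p] (D.augLoc D.PiXarrow (localToGF F k ι) (φ g)) =
          τ * AlgEquiv.restrictScalars ℚ_[p] (D.augLoc D.PiXarrow (localToGF F k ι) g) * τ⁻¹) :
    @GoodLocalFrobenioid.SplitFromF p k _ (GaloisValDatum.normVal k) (D.goodLocalFrobenioidOfEmb p k ι hX) :=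
  D.splitFromF_goodLocalFrobenioidOfEmb p k ι hX hd hΔC hΔ
    (GoodLocalFrobenioid.hE2_of_conj_restrictScalars p k (D.augLoc D.PiXarrow (localToGF F k ι)) hconj)

/-- **The same with `τ` in the literal `G_{ℚ_p} := Aut_{ℚ_p-alg}(AlgebraicClosure ℚ_[p])`** (the codomain of the tree's
`AbsTopIII.TemperedAutOverGQp`), after transport of `res ∘ aug` along ANY `ℚ_p`-algebra isomorphism `e : k̄ ≃ ℚ̄_p`
(`GaloisValDatum.nonempty_algEquiv_padicAlgCl`; every such `e` respects the valuations,
`GaloisValDatum.vle_map_algEquiv_padicAlgCl_iff`): «`∀ φ ∃ τ ∈ G_{ℚ_p} ∀ g, e·res(aug(φ g))·e⁻¹ = τ * e·res(aug g)·e⁻¹ * τ⁻¹`».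
What separates this hypothesis from an APPLICATION of `TemperedAutOverGQp` is only the identification of `Π_v̲` with an
open subgroup of finite index of the tempered group of an [EtTh] §1 setting compatibly with the augmentations — cell
bookkeeping not done here. ([IUTchI] Ex 3.3 (iii) (e) p.79) [claim: Mochizuki2012, status: disputed] -/
theorem splitFromF_goodLocalFrobenioidOfEmb_of_conj_autCongr [SecondCountableTopology D.PiC]
    (ι : Fbar →ₐ[K] AlgebraicClosure k) (hX : IsOpen (D.PiXarrow : Set D.PiC)) (hd : DenseRange (algebraMap K k))
    (hΔC : IsSlimGroup D.DeltaC)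
    (hΔ : ∀ φ : D.PiLoc D.PiXarrow (localToGF F k ι) ≃ₜ* D.PiLoc D.PiXarrow (localToGF F k ι),
      (D.augLoc D.PiXarrow (localToGF F k ι)).ker.map φ.toMulEquiv.toMonoidHom =
        (D.augLoc D.PiXarrow (localToGF F k ι)).ker)
    (e : AlgebraicClosure k ≃ₐ[ℚ_[p]] PadicAlgCl p)
    (hconj : ∀ φ : D.PiLoc D.PiXarrow (localToGF F k ι) ≃ₜ* D.PiLoc D.PiXarrow (localToGF F k ι),
      ∃ τ : PadicAlgCl p ≃ₐ[ℚ_[p]] PadicAlgCl p, ∀ g : D.PiLoc D.PiXarrow (localToGF F k ι),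
        e.autCongr (AlgEquiv.restrictScalars ℚ_[p] (D.augLoc D.PiXarrow (localToGF F k ι) (φ g))) =
          τ * e.autCongr (AlgEquiv.restrictScalars ℚ_[p] (D.augLoc D.PiXarrow (localToGF F k ι) g)) * τ⁻¹) :
    @GoodLocalFrobenioid.SplitFromF p k _ (GaloisValDatum.normVal k) (D.goodLocalFrobenioidOfEmb p k ι hX) :=
  D.splitFromF_goodLocalFrobenioidOfEmb_of_conj_restrictScalars p k ι hX hd hΔC hΔ
    (GoodLocalFrobenioid.conj_restrictScalars_of_conj_autCongr p k (D.augLoc D.PiXarrow (localToGF F k ι))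
      (fun φ : D.PiLoc D.PiXarrow (localToGF F k ι) ≃ₜ* D.PiLoc D.PiXarrow (localToGF F k ι) =>
        (φ : D.PiLoc D.PiXarrow (localToGF F k ι) → D.PiLoc D.PiXarrow (localToGF F k ι))) e hconj)

end InitialThetaData

end Datum

end Literature.IUT.HodgeTheaters

end
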